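import Mathlib
import Summits.QuantumFields.BalabanUV.Beta.UnitLatticeTubeCount
import Summits.QuantumFields.BalabanUV.Beta.UnitLatticeDecoratedResolvent

/-!
# `Summit.QuantumFields.BalabanUV.Beta.UnitLatticeDecoratedPaths` — A3-loc (iii)+(iv) in the PATH currency: credit on
# EVERY index link (`‖F(z,z′)‖·e^{δd(z,z′)}` = every factor run at rate `κ + δ`) absorbs a coefficient
# `‖c(b⃗)‖ ≤ A₀·e^{δ·pathLen(y)}` (every admissible chain `y`); with `UnitLatticeTubeCount` the s-decorated walk
# expansion gets a HYPOTHESIS-FREE polydisc bound (packing + diameters in, tube count discharged inside)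

HONEST FRAMING (page 1 of everything in this cell).  Discharging `FlowStep.BetaPertH` would make Bałaban's ultraviolet
stability UNCONDITIONAL — a constructive-QFT result; NOT the continuum limit, NOT the Clay problem.  This module
discharges nothing of `BetaPertH`; [folklore] algebra, kernel-checked (unit `b2b-balaban-beta-d4-p3`, road P3, gen 4;
skeleton v1.8 §7.4–§7.5: «the decoration growth is ABSORBED by running the spine at the rate κ′» taken literally — every
factor, not only the commutator link as in the gen-3 sepSum currency of `UnitLatticeDecoratedChains`).  CONTEXT (located,
not used): [13] CMP **99** p. 410 (3.93), Thm 3.10 p. 416 «depends on d and L only»; [II] CMP **116** p. 5 (1.11).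
HONEST DEPENDENCY: continuum YM on T⁴ ⇐ BetaPertH ∧ nine spine estimates (0/9 proved); BetaPertH ⇐
(D1) ∧ (D4) ∧ CAP+tail; G-an2-4 gates asym, D1 and NE2/3/4.

CONTENTS (0 sorry). §1 `credF`, `wrs_credF` (`wrs_κ(credF δ F) = wrs_{κ+δ} F`), majorants `headMajP`/`stepMajP`/`walkMajP`;
§2 `exists_chain_of_walkTerm_ne_zero`, **`norm_walkTerm_le_walkMajP`** (`e^{δℓ}·‖walkTerm n b⃗ (i,k)‖ ≤ walkMajP (i,k)` for
every `ℓ` below all admissible chain lengths ending at `k` — induction threading the chain through the products);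
§3 `sum_walkMajP_eq`, `wrs_headMajPSum` (≤ N·C_L′), `wrs_stepMajPSum` (≤ (2N/M)·C_L′·K₁′; primes at rate `κ + δ`);
§4 ENDs **`wrs_decoratedSum_path`**, **`wrs_decSum_path`** (tube property `#dec ≤ c₀ + c₁·pathLen(y)`), and the
HYPOTHESIS-FREE **`wrs_decSum_tube`** for `dec = tubeDec cellOf E`: `≤ e^{κ₁P}·(N·C_L′)·Σ_{n<m}((2N/M)·C_L′·K₁′)ⁿ` at rate
shift `κ₁P/r` — per-term, volume-free constants; the rate condition `κ + κ₁P/r ≤ κ₀` is Bałaban's R1 («δ₁M ≥ κ₁»).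
NOT HERE: the near∕far refinement (ii) inside the terms, the `RowData` hand-off (sibling), any instance.  NOT summit progress.
-/

open scoped BigOperators Matrix
open Finset Matrix

namespace Summit.QuantumFields.BalabanUV.Beta.UnitLatticeDecoratedPaths

open Summit.QuantumFields.BalabanUV.Beta.UnitLatticeWalkInversion
open Summit.QuantumFields.BalabanUV.Beta.UnitLatticeWalkTerms
open Summit.QuantumFields.BalabanUV.Beta.UnitLatticeDecoratedChains (wrs_sum_le_real)
open Summit.QuantumFields.BalabanUV.Beta.UnitLatticeDecoratedResolvent (decCoeff decSum norm_decCoeff_le)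
open Summit.QuantumFields.BalabanUV.Beta.UnitLatticeTubeCount
  (pathLen pathLen_snoc pathLen_nonneg tubeDec card_tubeDec_le)
open Literature.MathematicalPhysics.QuantumFieldTheory.Balaban1983to89.B13PerturbativeStep
  (wrs WRS WeightHyp wrs_mul_le wrs_add_le)

noncomputable section

variable {Y : Type*} [Fintype Y] [DecidableEq Y] {B : Type*}

/-! ## §1 Credit-weighted majorants -/

/-- The CREDIT-WEIGHTED entrywise majorant of a factor: `‖F(i,j)‖·e^{δd(i,j)}`. [folklore] -/
def credF (δ : ℝ) (d : Y → Y → ℝ) (F : Matrix Y Y ℂ) : Matrix Y Y ℝ := fun i j => ‖F i j‖ * Real.exp (δ * d i j)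

omit [Fintype Y] [DecidableEq Y] in
/-- `credF ≥ 0` entrywise. [folklore] -/
theorem credF_nonneg (δ : ℝ) (d : Y → Y → ℝ) (F : Matrix Y Y ℂ) (i j : Y) : 0 ≤ credF δ d F i j :=
  mul_nonneg (norm_nonneg _) (Real.exp_pos _).le

omit [Fintype Y] [DecidableEq Y] in
/-- `‖F(i,j)‖ ≤ credF δ F (i,j)` for `δ ≥ 0`, `d ≥ 0`. [folklore] -/
theorem norm_le_credF {δ : ℝ} (hδ : 0 ≤ δ) {d : Y → Y → ℝ} (F : Matrix Y Y ℂ) {i j : Y} (hd : 0 ≤ d i j) :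
    ‖F i j‖ ≤ credF δ d F i j :=
  le_mul_of_one_le_right (norm_nonneg _) (Real.one_le_exp (mul_nonneg hδ hd))

omit [DecidableEq Y] in
/-- **`wrs_κ(credF δ F) = wrs_{κ+δ}(F)`**: the credit is exactly a rate shift. [folklore] -/
theorem wrs_credF (κ δ : ℝ) (d : Y → Y → ℝ) (F : Matrix Y Y ℂ) (i : Y) :
    wrs κ d (credF δ d F) i = wrs (κ + δ) d F i := by
  unfold wrs credF
  refine Finset.sum_congr rfl fun j _ => ?_
  rw [Real.norm_of_nonneg (mul_nonneg (norm_nonneg _) (Real.exp_pos _).le), mul_assoc, ← Real.exp_add]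
  ring_nf

/-- Head majorant with credit: `credF δ (H_bL_bH_b)`. [folklore] -/
def headMajP (δ : ℝ) (d : Y → Y → ℝ) (h : B → Y → ℝ) (L : B → Matrix Y Y ℂ) (b : B) : Matrix Y Y ℝ :=
  credF δ d (headFactor h L b)

/-- Step majorant with credit on BOTH links: `credF δ [H_b,K′] · credF δ (L_bH_b)`. [folklore] -/
def stepMajP (δ : ℝ) (d : Y → Y → ℝ) (h : B → Y → ℝ) (K' : Matrix Y Y ℂ) (L : B → Matrix Y Y ℂ) (b : B) :
    Matrix Y Y ℝ :=
  credF δ d (Hd h b * K' - K' * Hd h b) * credF δ d (L b * Hd h b)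

/-- Walk majorant with credit (same recursion as `walkTerm`). [folklore] -/
def walkMajP (δ : ℝ) (d : Y → Y → ℝ) (h : B → Y → ℝ) (K' : Matrix Y Y ℂ) (L : B → Matrix Y Y ℂ) :
    (n : ℕ) → (Fin (n + 1) → B) → Matrix Y Y ℝ
  | 0, b => headMajP δ d h L (b 0)
  | n + 1, b => walkMajP δ d h K' L n (Fin.init b) * stepMajP δ d h K' L (b (Fin.last (n + 1)))

/-- `walkMajP ≥ 0` entrywise. [folklore] -/
theorem walkMajP_nonneg (δ : ℝ) (d : Y → Y → ℝ) (h : B → Y → ℝ) (K' : Matrix Y Y ℂ) (L : B → Matrix Y Y ℂ) :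
    ∀ (n : ℕ) (b : Fin (n + 1) → B) (i j : Y), 0 ≤ walkMajP δ d h K' L n b i j
  | 0, b, i, j => credF_nonneg _ _ _ _ _
  | n + 1, b, i, j => by
      rw [walkMajP, Matrix.mul_apply]
      exact Finset.sum_nonneg fun k _ => mul_nonneg (walkMajP_nonneg δ d h K' L n _ i k) (by
        rw [stepMajP, Matrix.mul_apply]
        exact Finset.sum_nonneg fun l _ => mul_nonneg (credF_nonneg _ _ _ _ _) (credF_nonneg _ _ _ _ _))

/-! ## §2 The chain credit -/

/-- A nonzero entry `walkTerm n b⃗ (i,k)` is witnessed by an ADMISSIBLE CHAIN ending at `k`: one point per cube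
neighbourhood, `y_t ∈ □̃_{b_t}`, `y_n = k` (the right factors `H_{b_t}` pin the column indices). [folklore] -/
theorem exists_chain_of_walkTerm_ne_zero (h : B → Y → ℝ) (E : B → Finset Y) (hsupp : ∀ b y, y ∉ E b → h b y = 0)
    (K' : Matrix Y Y ℂ) (L : B → Matrix Y Y ℂ) :
    ∀ (n : ℕ) (b : Fin (n + 1) → B) (i k : Y), walkTerm h K' L n b i k ≠ 0 →
      ∃ y : Fin (n + 1) → Y, (∀ t, y t ∈ E (b t)) ∧ y (Fin.last n) = k
  | 0, b, i, k, hne => by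
      have hk : k ∈ E (b (Fin.last 0)) :=
        by_contra fun hk => hne (walkTerm_apply_eq_zero_of_col h E hsupp K' L 0 b i k hk)
      refine ⟨fun _ => k, fun t => ?_, rfl⟩
      have ht : t = Fin.last 0 := Fin.ext (by have := t.isLt; simp only [Fin.val_last]; omega)
      exact ht ▸ hk
  | n + 1, b, i, m, hne => by
      have hm : m ∈ E (b (Fin.last (n + 1))) :=
        by_contra fun hm => hne (walkTerm_apply_eq_zero_of_col h E hsupp K' L (n + 1) b i m hm)
      rw [walkTerm, Matrix.mul_apply] at hne
      obtain ⟨k, _, hk⟩ := Finset.exists_ne_zero_of_sum_ne_zero hne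
      have hT : walkTerm h K' L n (Fin.init b) i k ≠ 0 := fun h0 => hk (by rw [h0, zero_mul])
      obtain ⟨y, hy, hyk⟩ := exists_chain_of_walkTerm_ne_zero h E hsupp K' L n (Fin.init b) i k hT
      refine ⟨Fin.snoc y m, fun t => ?_, Fin.snoc_last _ _⟩
      rcases Fin.eq_castSucc_or_eq_last t with ⟨t', rfl⟩ | rfl
      · rw [Fin.snoc_castSucc]; exact hy t'
      · rw [Fin.snoc_last]; exact hm

/-- **THE CHAIN CREDIT.**  For `δ ≥ 0`, `d` nonnegative with the triangle inequality, supports `supp h_b ⊆ □̃_b`: for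
every `b⃗`, row `i`, column `k` and every `ℓ` BELOW the lengths of all admissible chains ending at `k` (`y_t ∈ □̃_{b_t}`,
`y_n = k`), `e^{δℓ}·‖walkTerm n b⃗ (i,k)‖ ≤ walkMajP δ n b⃗ (i,k)` (entry `(i,k)` is a sum over index chains through the
products, each visiting one point per cube in order; the credit splits over the links). [folklore] -/
theorem norm_walkTerm_le_walkMajP (h : B → Y → ℝ) (E : B → Finset Y) (hsupp : ∀ b y, y ∉ E b → h b y = 0)
    (K' : Matrix Y Y ℂ) (L : B → Matrix Y Y ℂ) {δ : ℝ} (hδ : 0 ≤ δ) (d : Y → Y → ℝ) (hd0 : ∀ a c, 0 ≤ d a c)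
    (htri : ∀ a c e, d a e ≤ d a c + d c e) :
    ∀ (n : ℕ) (b : Fin (n + 1) → B) (i k : Y) (ℓ : ℝ),
      (∀ y : Fin (n + 1) → Y, (∀ t, y t ∈ E (b t)) → y (Fin.last n) = k → ℓ ≤ pathLen d n y) →
      Real.exp (δ * ℓ) * ‖walkTerm h K' L n b i k‖ ≤ walkMajP δ d h K' L n b i k
  | 0, b, i, k, ℓ, hℓ => by
      by_cases hne : walkTerm h K' L 0 b i k = 0
      · rw [hne, norm_zero, mul_zero]
        exact walkMajP_nonneg δ d h K' L 0 b i k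
      · obtain ⟨y, hy, hyk⟩ := exists_chain_of_walkTerm_ne_zero h E hsupp K' L 0 b i k hne
        have h0 : ℓ ≤ 0 := by simpa [pathLen] using hℓ y hy hyk
        have he : Real.exp (δ * ℓ) ≤ 1 := Real.exp_le_one_iff.2 (mul_nonpos_of_nonneg_of_nonpos hδ h0)
        calc Real.exp (δ * ℓ) * ‖walkTerm h K' L 0 b i k‖ ≤ 1 * ‖walkTerm h K' L 0 b i k‖ :=
              mul_le_mul_of_nonneg_right he (norm_nonneg _)
          _ = ‖headFactor h L (b 0) i k‖ := by rw [one_mul]; rfl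
          _ ≤ walkMajP δ d h K' L 0 b i k := norm_le_credF hδ _ (hd0 i k)
  | n + 1, b, i, m, ℓ, hℓ => by
      by_cases hm : m ∈ E (b (Fin.last (n + 1)))
      · set b' := b (Fin.last (n + 1)) with hb'
        set C := Hd h b' * K' - K' * Hd h b' with hC
        set LH := L b' * Hd h b' with hLH
        have hstep : stepFactor h K' L b' = C * LH := by rw [stepFactor, hC, hLH, Matrix.mul_assoc]
        have IH : ∀ k l : Y, Real.exp (δ * (ℓ - d k l - d l m)) * ‖walkTerm h K' L n (Fin.init b) i k‖
            ≤ walkMajP δ d h K' L n (Fin.init b) i k := by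
          intro k l
          refine norm_walkTerm_le_walkMajP h E hsupp K' L hδ d hd0 htri n (Fin.init b) i k _ fun y hy hyk => ?_
          have hadm : ∀ t, (Fin.snoc y m : Fin (n + 2) → Y) t ∈ E (b t) := by
            intro t
            rcases Fin.eq_castSucc_or_eq_last t with ⟨t', rfl⟩ | rfl
            · rw [Fin.snoc_castSucc]; exact hy t'
            · rw [Fin.snoc_last]; exact hm
          have h1 := hℓ (Fin.snoc y m) hadm (Fin.snoc_last _ _)
          rw [pathLen_snoc, hyk] at h1
          have h2 := htri k l m
          linarith
        rw [walkTerm, walkMajP, Matrix.mul_apply, Matrix.mul_apply, hstep]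
        calc Real.exp (δ * ℓ) * ‖∑ k, walkTerm h K' L n (Fin.init b) i k * (C * LH) k m‖
            ≤ Real.exp (δ * ℓ) * ∑ k, ‖walkTerm h K' L n (Fin.init b) i k‖ * ‖(C * LH) k m‖ := by
              refine mul_le_mul_of_nonneg_left ?_ (Real.exp_pos _).le
              exact (norm_sum_le _ _).trans (le_of_eq (Finset.sum_congr rfl fun k _ => norm_mul _ _))
          _ = ∑ k, Real.exp (δ * ℓ) * ‖walkTerm h K' L n (Fin.init b) i k‖ * ‖(C * LH) k m‖ := by
              rw [Finset.mul_sum]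
              exact Finset.sum_congr rfl fun k _ => by ring
          _ ≤ ∑ k, walkMajP δ d h K' L n (Fin.init b) i k * stepMajP δ d h K' L b' k m := by
              refine Finset.sum_le_sum fun k _ => ?_
              rw [stepMajP, ← hC, ← hLH, Matrix.mul_apply, Matrix.mul_apply, Finset.mul_sum]
              calc Real.exp (δ * ℓ) * ‖walkTerm h K' L n (Fin.init b) i k‖ * ‖∑ l, C k l * LH l m‖
                  ≤ Real.exp (δ * ℓ) * ‖walkTerm h K' L n (Fin.init b) i k‖ * ∑ l, ‖C k l‖ * ‖LH l m‖ := by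
                    refine mul_le_mul_of_nonneg_left ?_ (by positivity)
                    exact (norm_sum_le _ _).trans (le_of_eq (Finset.sum_congr rfl fun l _ => norm_mul _ _))
                _ = ∑ l, (Real.exp (δ * (ℓ - d k l - d l m)) * ‖walkTerm h K' L n (Fin.init b) i k‖)
                      * (credF δ d C k l * credF δ d LH l m) := by
                    rw [Finset.mul_sum]
                    refine Finset.sum_congr rfl fun l _ => ?_
                    have hexp : Real.exp (δ * ℓ)
                        = Real.exp (δ * (ℓ - d k l - d l m)) * Real.exp (δ * d k l) * Real.exp (δ * d l m) := by
                      rw [← Real.exp_add, ← Real.exp_add]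
                      ring_nf
                    rw [credF, credF, hexp]
                    ring
                _ ≤ ∑ l, walkMajP δ d h K' L n (Fin.init b) i k * (credF δ d C k l * credF δ d LH l m) :=
                    Finset.sum_le_sum fun l _ => mul_le_mul_of_nonneg_right (IH k l)
                      (mul_nonneg (credF_nonneg _ _ _ _ _) (credF_nonneg _ _ _ _ _))
      · rw [walkTerm_apply_eq_zero_of_col h E hsupp K' L (n + 1) b i m hm, norm_zero, mul_zero]
        exact walkMajP_nonneg δ d h K' L (n + 1) b i m

/-! ## §3 Recombination over cube sequences and budgets -/

/-- `headMajPSum = Σ_b headMajP b`. [folklore] -/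
def headMajPSum [Fintype B] (δ : ℝ) (d : Y → Y → ℝ) (h : B → Y → ℝ) (L : B → Matrix Y Y ℂ) : Matrix Y Y ℝ :=
  ∑ b, headMajP δ d h L b

/-- `stepMajPSum = Σ_b stepMajP b`. [folklore] -/
def stepMajPSum [Fintype B] (δ : ℝ) (d : Y → Y → ℝ) (h : B → Y → ℝ) (K' : Matrix Y Y ℂ) (L : B → Matrix Y Y ℂ) :
    Matrix Y Y ℝ :=
  ∑ b, stepMajP δ d h K' L b

/-- **`headMajPSum·(stepMajPSum)ⁿ = Σ_{b⃗} walkMajP n b⃗`** (as `UnitLatticeWalkTerms.Ptot_mul_Rem_pow`). [folklore] -/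
theorem sum_walkMajP_eq [Fintype B] (δ : ℝ) (d : Y → Y → ℝ) (h : B → Y → ℝ) (K' : Matrix Y Y ℂ)
    (L : B → Matrix Y Y ℂ) :
    ∀ n : ℕ, headMajPSum δ d h L * stepMajPSum δ d h K' L ^ n = ∑ b : Fin (n + 1) → B, walkMajP δ d h K' L n b
  | 0 => by
      rw [pow_zero, Matrix.mul_one, headMajPSum]
      exact (Equiv.sum_comp (Equiv.funUnique (Fin 1) B) (fun b => headMajP δ d h L b)).symm
  | n + 1 => by
      rw [pow_succ, ← Matrix.mul_assoc, sum_walkMajP_eq δ d h K' L n, stepMajPSum, Finset.sum_mul_sum]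
      rw [← Equiv.sum_comp (Fin.snocEquiv fun _ => B) (fun b' => walkMajP δ d h K' L (n + 1) b'),
        Fintype.sum_prod_type]
      rw [Finset.sum_comm]
      refine Finset.sum_congr rfl fun c _ => Finset.sum_congr rfl fun b _ => Eq.symm ?_
      exact (by rw [walkMajP, Fin.init_snoc, Fin.snoc_last] : walkMajP δ d h K' L (n + 1) (Fin.snoc b c) = _)

section Wrs

variable {κ : ℝ} {d : Y → Y → ℝ}

/-- **`WRS κ d headMajPSum ≤ N·C_L′`** with `C_L′` the local-inverse budget AT RATE `κ + δ`. [folklore] -/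
theorem wrs_headMajPSum [Fintype B] {δ : ℝ} (h : B → Y → ℝ) (E : B → Finset Y) (L : B → Matrix Y Y ℂ)
    (hsupp : ∀ b y, y ∉ E b → h b y = 0) (habs : ∀ b y, |h b y| ≤ 1) {N C_L : ℝ} (hC : 0 ≤ C_L)
    (hN : ∀ y, ((Finset.univ.filter fun b => y ∈ E b).card : ℝ) ≤ N) (hL : ∀ b, WRS (κ + δ) d (L b) C_L) :
    WRS κ d (headMajPSum δ d h L) (N * C_L) := by
  intro i
  calc wrs κ d (headMajPSum δ d h L) i ≤ ∑ b, wrs κ d (headMajP δ d h L b) i := wrs_sum_le_real _ _ i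
    _ = ∑ b, wrs (κ + δ) d (headFactor h L b) i :=
        Finset.sum_congr rfl fun b _ => wrs_credF κ δ d (headFactor h L b) i
    _ ≤ ∑ b, |h b i| * C_L := Finset.sum_le_sum fun b _ =>
        (wrs_Hd_mul_mul_Hd_le h habs b (L b) i).trans (mul_le_mul_of_nonneg_left (hL b i) (abs_nonneg _))
    _ = (∑ b, |h b i|) * C_L := by rw [Finset.sum_mul]
    _ ≤ N * C_L := mul_le_mul_of_nonneg_right ((sum_abs_h_le h E hsupp habs i).trans (hN i)) hC

/-- `wrs` of one credit step majorant: `≤ Σ_l |h_b(k) − h_b(l)|·‖K′(k,l)‖·e^{(κ+δ)d(k,l)}·C_L′`. [folklore] -/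
theorem wrs_stepMajP_le (hw : WeightHyp κ d) {δ : ℝ} (h : B → Y → ℝ) (habs : ∀ b y, |h b y| ≤ 1)
    (K' : Matrix Y Y ℂ) (L : B → Matrix Y Y ℂ) {C_L : ℝ} (hL : ∀ b, WRS (κ + δ) d (L b) C_L) (b : B) (k : Y) :
    wrs κ d (stepMajP δ d h K' L b) k ≤ ∑ l, |h b k - h b l| * ‖K' k l‖ * Real.exp ((κ + δ) * d k l) * C_L := by
  rw [stepMajP]
  refine (wrs_mul_le hw _ _ k).trans ?_
  refine Finset.sum_le_sum fun l _ => ?_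
  have hLH : wrs κ d (credF δ d (L b * Hd h b)) l ≤ C_L := by
    rw [wrs_credF]
    exact (wrs_mul_Hd_le h habs b (L b) l).trans (hL b l)
  have hentry : ‖credF δ d (Hd h b * K' - K' * Hd h b) k l‖ * Real.exp (κ * d k l)
      = |h b k - h b l| * ‖K' k l‖ * Real.exp ((κ + δ) * d k l) := by
    rw [Real.norm_of_nonneg (credF_nonneg _ _ _ _ _), credF, comm_apply, norm_mul, ← Complex.ofReal_sub,
      Complex.norm_real, Real.norm_eq_abs, mul_assoc, ← Real.exp_add]
    ring_nf
  rw [hentry]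
  exact mul_le_mul_of_nonneg_left hLH (by positivity)

/-- **`WRS κ d stepMajPSum ≤ (2N/M)·C_L′·K₁′`** with `K₁′` the first exponential moment of `K′` at rate `κ + δ`. [folklore] -/
theorem wrs_stepMajPSum [Fintype B] (hw : WeightHyp κ d) {δ : ℝ} (K' : Matrix Y Y ℂ) (h : B → Y → ℝ)
    (E : B → Finset Y) (L : B → Matrix Y Y ℂ) (hsupp : ∀ b y, y ∉ E b → h b y = 0) (habs : ∀ b y, |h b y| ≤ 1)
    {M N C_L K₁ : ℝ} (hM : 0 < M) (hLip : ∀ b y y', |h b y - h b y'| ≤ d y y' / M)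
    (hN : ∀ y, ((Finset.univ.filter fun b => y ∈ E b).card : ℝ) ≤ N) (hC : 0 ≤ C_L)
    (hL : ∀ b, WRS (κ + δ) d (L b) C_L) (hK₁ : ∀ i, ∑ j, ‖K' i j‖ * d i j * Real.exp ((κ + δ) * d i j) ≤ K₁) :
    WRS κ d (stepMajPSum δ d h K' L) (2 * N / M * C_L * K₁) := by
  intro k
  calc wrs κ d (stepMajPSum δ d h K' L) k
      ≤ ∑ b, wrs κ d (stepMajP δ d h K' L b) k := wrs_sum_le_real _ _ k
    _ ≤ ∑ b, ∑ l, |h b k - h b l| * ‖K' k l‖ * Real.exp ((κ + δ) * d k l) * C_L :=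
        Finset.sum_le_sum fun b _ => wrs_stepMajP_le hw h habs K' L hL b k
    _ = ∑ l, (∑ b, |h b k - h b l|) * (‖K' k l‖ * Real.exp ((κ + δ) * d k l) * C_L) := by
        rw [Finset.sum_comm]
        refine Finset.sum_congr rfl fun l _ => ?_
        rw [Finset.sum_mul]
        exact Finset.sum_congr rfl fun b _ => by ring
    _ ≤ ∑ l, (2 * N * d k l / M) * (‖K' k l‖ * Real.exp ((κ + δ) * d k l) * C_L) :=
        Finset.sum_le_sum fun l _ => mul_le_mul_of_nonneg_right
          (sum_abs_h_sub_le h E hsupp hM hLip hw.nonneg hN k l) (by positivity)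
    _ = 2 * N / M * C_L * ∑ l, ‖K' k l‖ * d k l * Real.exp ((κ + δ) * d k l) := by
        rw [Finset.mul_sum]
        exact Finset.sum_congr rfl fun l _ => by ring
    _ ≤ 2 * N / M * C_L * K₁ := by
        have hN0 : 0 ≤ N := le_trans (by positivity) (hN k)
        exact mul_le_mul_of_nonneg_left (hK₁ k) (by positivity)

/-! ## §4 ENDs -/

/-- **DECORATED SUMS, PATH CURRENCY.**  If `‖c(b⃗)‖ ≤ A₀·e^{δ·pathLen(y)}` for EVERY admissible point chain `y`
(`y_t ∈ □̃_{b_t}`), then `WRS κ d (Σ_{b⃗} c(b⃗)•walkTerm n b⃗) (A₀·(N·C_L′)·((2N/M)·C_L′·K₁′)ⁿ)` with the local-inverse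
budget `C_L′` and the first moment `K₁′` taken AT RATE `κ + δ`; no volume factor, no per-step factor. [folklore] -/
theorem wrs_decoratedSum_path [Fintype B] (hw : WeightHyp κ d) (K' : Matrix Y Y ℂ) (h : B → Y → ℝ)
    (E : B → Finset Y) (L : B → Matrix Y Y ℂ) (hsupp : ∀ b y, y ∉ E b → h b y = 0) (habs : ∀ b y, |h b y| ≤ 1)
    {M N C_L K₁ δ A₀ : ℝ} (hM : 0 < M) (hLip : ∀ b y y', |h b y - h b y'| ≤ d y y' / M)
    (hN : ∀ y, ((Finset.univ.filter fun b => y ∈ E b).card : ℝ) ≤ N) (hC : 0 ≤ C_L)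
    (hL : ∀ b, WRS (κ + δ) d (L b) C_L) (hδ : 0 ≤ δ) (hA₀ : 0 ≤ A₀)
    (hK₁ : ∀ i, ∑ j, ‖K' i j‖ * d i j * Real.exp ((κ + δ) * d i j) ≤ K₁)
    (n : ℕ) (c : (Fin (n + 1) → B) → ℂ)
    (hc : ∀ (b : Fin (n + 1) → B) (y : Fin (n + 1) → Y), (∀ t, y t ∈ E (b t)) →
      ‖c b‖ ≤ A₀ * Real.exp (δ * pathLen d n y)) :
    WRS κ d (∑ b : Fin (n + 1) → B, c b • walkTerm h K' L n b) (A₀ * (N * C_L) * (2 * N / M * C_L * K₁) ^ n) := by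
  classical
  have hterm : ∀ (b : Fin (n + 1) → B) (i j : Y), ‖c b‖ * ‖walkTerm h K' L n b i j‖ ≤ A₀ * walkMajP δ d h K' L n b i j := by
    intro b i j
    by_cases hne : walkTerm h K' L n b i j = 0
    · rw [hne, norm_zero, mul_zero]
      exact mul_nonneg hA₀ (walkMajP_nonneg δ d h K' L n b i j)
    · set S := (Finset.univ : Finset (Fin (n + 1) → Y)).filter fun y => (∀ t, y t ∈ E (b t)) ∧ y (Fin.last n) = j
        with hS
      have hSne : S.Nonempty := by
        obtain ⟨y, hy, hyj⟩ := exists_chain_of_walkTerm_ne_zero h E hsupp K' L n b i j hne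
        exact ⟨y, Finset.mem_filter.2 ⟨Finset.mem_univ _, hy, hyj⟩⟩
      obtain ⟨y₀, hy₀, hmin⟩ := Finset.exists_min_image S (pathLen d n) hSne
      have hy₀' := (Finset.mem_filter.1 hy₀).2
      have hlow : ∀ y : Fin (n + 1) → Y, (∀ t, y t ∈ E (b t)) → y (Fin.last n) = j →
          pathLen d n y₀ ≤ pathLen d n y :=
        fun y hy hyj => hmin y (Finset.mem_filter.2 ⟨Finset.mem_univ _, hy, hyj⟩)
      have h1 := norm_walkTerm_le_walkMajP h E hsupp K' L hδ d hw.nonneg hw.tri n b i j _ hlow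
      have h2 := hc b y₀ hy₀'.1
      calc ‖c b‖ * ‖walkTerm h K' L n b i j‖
          ≤ A₀ * Real.exp (δ * pathLen d n y₀) * ‖walkTerm h K' L n b i j‖ :=
            mul_le_mul_of_nonneg_right h2 (norm_nonneg _)
        _ = A₀ * (Real.exp (δ * pathLen d n y₀) * ‖walkTerm h K' L n b i j‖) := by ring
        _ ≤ A₀ * walkMajP δ d h K' L n b i j := mul_le_mul_of_nonneg_left h1 hA₀
  have hmaj : ∀ i j, ‖(∑ b : Fin (n + 1) → B, c b • walkTerm h K' L n b) i j‖
      ≤ A₀ * (headMajPSum δ d h L * stepMajPSum δ d h K' L ^ n) i j := by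
    intro i j
    rw [sum_walkMajP_eq δ d h K' L n, Matrix.sum_apply, Matrix.sum_apply, Finset.mul_sum]
    refine (norm_sum_le _ _).trans (Finset.sum_le_sum fun b _ => ?_)
    rw [Matrix.smul_apply, smul_eq_mul, norm_mul]
    exact hterm b i j
  have hPR : WRS κ d (headMajPSum δ d h L * stepMajPSum δ d h K' L ^ n) ((N * C_L) * (2 * N / M * C_L * K₁) ^ n) :=
    (wrs_headMajPSum h E L hsupp habs hC hN hL).mul hw
      ((wrs_stepMajPSum hw K' h E L hsupp habs hM hLip hN hC hL hK₁).pow hw n)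
  have hnonneg : ∀ i j, 0 ≤ (headMajPSum δ d h L * stepMajPSum δ d h K' L ^ n) i j := by
    intro i j
    rw [sum_walkMajP_eq δ d h K' L n, Matrix.sum_apply]
    exact Finset.sum_nonneg fun b _ => walkMajP_nonneg δ d h K' L n b i j
  refine WRS.of_majorant hmaj fun i => ?_
  calc ∑ j, A₀ * (headMajPSum δ d h L * stepMajPSum δ d h K' L ^ n) i j * Real.exp (κ * d i j)
      = A₀ * wrs κ d (headMajPSum δ d h L * stepMajPSum δ d h K' L ^ n) i := by
        rw [wrs, Finset.mul_sum]
        refine Finset.sum_congr rfl fun j _ => ?_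
        rw [Real.norm_of_nonneg (hnonneg i j)]
        ring
    _ ≤ A₀ * ((N * C_L) * (2 * N / M * C_L * K₁) ^ n) := mul_le_mul_of_nonneg_left (hPR i) hA₀
    _ = A₀ * (N * C_L) * (2 * N / M * C_L * K₁) ^ n := by ring

/-- **THE POLYDISC BOUND, PATH CURRENCY.**  Tube property `#dec(b⃗) ≤ c₀ + c₁·pathLen(y)` for every admissible chain
`y` (`c₁ ≥ 0` a slope; in `UnitLatticeTubeCount`'s letters `c₁ = P/r`), budgets at rate `κ + κ₁c₁`; then on
`‖s(Δ)‖ ≤ e^{κ₁}`: `WRS κ d (decSum m) (e^{κ₁c₀}·(N·C_L′)·Σ_{n<m}((2N/M)·C_L′·K₁′)ⁿ)`. [folklore] -/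
theorem wrs_decSum_path [Fintype B] {Δ : Type*} (hw : WeightHyp κ d) (K' : Matrix Y Y ℂ) (h : B → Y → ℝ)
    (E : B → Finset Y) (L : B → Matrix Y Y ℂ) (hsupp : ∀ b y, y ∉ E b → h b y = 0) (habs : ∀ b y, |h b y| ≤ 1)
    {M N C_L K₁ κ₁ c₀ c₁ : ℝ} (hM : 0 < M) (hLip : ∀ b y y', |h b y - h b y'| ≤ d y y' / M)
    (hN : ∀ y, ((Finset.univ.filter fun b => y ∈ E b).card : ℝ) ≤ N) (hC : 0 ≤ C_L)
    (hL : ∀ b, WRS (κ + κ₁ * c₁) d (L b) C_L) (hκ₁ : 0 ≤ κ₁) (hc₁ : 0 ≤ c₁)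
    (hK₁ : ∀ i, ∑ j, ‖K' i j‖ * d i j * Real.exp ((κ + κ₁ * c₁) * d i j) ≤ K₁)
    (s : Δ → ℂ) (hs : ∀ δ, ‖s δ‖ ≤ Real.exp κ₁) (dec : (n : ℕ) → (Fin (n + 1) → B) → Finset Δ)
    (htube : ∀ (n : ℕ) (b : Fin (n + 1) → B) (y : Fin (n + 1) → Y), (∀ t, y t ∈ E (b t)) →
      ((dec n b).card : ℝ) ≤ c₀ + c₁ * pathLen d n y) (m : ℕ) :
    WRS κ d (decSum h K' L s dec m)
      (Real.exp (κ₁ * c₀) * (N * C_L) * ∑ n ∈ Finset.range m, (2 * N / M * C_L * K₁) ^ n) := by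
  intro i
  rw [decSum, Finset.mul_sum]
  refine (wrs_sum_le _ _ i).trans (Finset.sum_le_sum fun n _ => ?_)
  refine wrs_decoratedSum_path hw K' h E L hsupp habs hM hLip hN hC hL (mul_nonneg hκ₁ hc₁) (Real.exp_pos _).le hK₁
    n (decCoeff s dec n) (fun b y hy => ?_) i
  refine (norm_decCoeff_le s dec hs n b).trans ?_
  rw [← Real.exp_add]
  refine Real.exp_le_exp.2 ?_
  have := mul_le_mul_of_nonneg_left (htube n b y hy) hκ₁
  calc κ₁ * ((dec n b).card : ℝ) ≤ κ₁ * (c₀ + c₁ * pathLen d n y) := this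
    _ = κ₁ * c₀ + κ₁ * c₁ * pathLen d n y := by ring

/-- **HYPOTHESIS-FREE END.**  The CONCRETE decoration `tubeDec cellOf E` (all cells met by `⋃_t □̃_{b_t}`) under PACKING
(`P` cells per ball of radius `R ≥ r + D`, `D` = diameter of the `□̃_b`): on `‖s(Δ)‖ ≤ e^{κ₁}`,
`WRS κ d (decSum h K′ L s (tubeDec cellOf E) m) (e^{κ₁P}·(N·C_L′)·Σ_{n<m}((2N/M)·C_L′·K₁′)ⁿ)` with the budgets at rate
`κ + κ₁·(P/r)` — the tube count (iii) DISCHARGED inside; constants per term, volume-free; the rate condition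
`κ + κ₁P/r ≤ κ₀` is Bałaban's R1 («δ₁M ≥ κ₁»). [folklore] -/
theorem wrs_decSum_tube [Fintype B] {Δ : Type*} [DecidableEq Δ] (hw : WeightHyp κ d) (K' : Matrix Y Y ℂ)
    (h : B → Y → ℝ) (E : B → Finset Y) (L : B → Matrix Y Y ℂ) (hsupp : ∀ b y, y ∉ E b → h b y = 0)
    (habs : ∀ b y, |h b y| ≤ 1) {M N C_L K₁ κ₁ r D R : ℝ} (hM : 0 < M)
    (hLip : ∀ b y y', |h b y - h b y'| ≤ d y y' / M) (hN : ∀ y, ((Finset.univ.filter fun b => y ∈ E b).card : ℝ) ≤ N)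
    (hC : 0 ≤ C_L) (hκ₁ : 0 ≤ κ₁) (hr : 0 < r) (hRD : r + D ≤ R) (cellOf : Y → Δ) {P : ℕ}
    (hpack : ∀ a : Y, ∃ S : Finset Δ, S.card ≤ P ∧ ∀ z, d a z ≤ R → cellOf z ∈ S)
    (hdiam : ∀ b, ∀ z ∈ E b, ∀ z' ∈ E b, d z z' ≤ D)
    (hL : ∀ b, WRS (κ + κ₁ * (P / r)) d (L b) C_L)
    (hK₁ : ∀ i, ∑ j, ‖K' i j‖ * d i j * Real.exp ((κ + κ₁ * (P / r)) * d i j) ≤ K₁)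
    (s : Δ → ℂ) (hs : ∀ δ, ‖s δ‖ ≤ Real.exp κ₁) (m : ℕ) :
    WRS κ d (decSum h K' L s (tubeDec cellOf E) m)
      (Real.exp (κ₁ * P) * (N * C_L) * ∑ n ∈ Finset.range m, (2 * N / M * C_L * K₁) ^ n) :=
  wrs_decSum_path hw K' h E L hsupp habs hM hLip hN hC hL hκ₁ (div_nonneg (Nat.cast_nonneg P) hr.le) hK₁ s hs
    (tubeDec cellOf E) (fun n b y hy => by
      have hcnt := card_tubeDec_le d hw.tri hw.zero hw.nonneg hr hRD cellOf hpack E hdiam b y hy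
      calc ((tubeDec cellOf E n b).card : ℝ) ≤ P * (1 + pathLen d n y / r) := hcnt
        _ = P + P / r * pathLen d n y := by ring) m

end Wrs

end

end Summit.QuantumFields.BalabanUV.Beta.UnitLatticeDecoratedPaths
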